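import Summits.Ventures.PercRepro.Night2FatDegFree

/-!
# night-2: points of `W ∖ {x}` on no NON-class basis line (unloaded singletons)

A point `y` of `W ∖ {x}` whose level-2 target `Q ∪ {x, y}` is unloaded: every basis line through `y` is a class line
(`dload_eq_zero_of_singleton_of_class`).  In the singly degenerate regime:
* **`single_class_of_plane_point`**: a point of `π₂` off the spine is such a point when the basis lines of `π₂`
  through it (spine–off or off–off pairs) are class lines — a basis line through it has no side basis point;
* **`single_class_of_spine_point`**: a spine point off `clF M` is such a point when the off–off basis lines through it
  are class lines — the spine itself is a class line, and a spine–off basis line does not pass through it;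
* **`single_class_of_side_point`**: a side point is such a point when the line of `M` is not a non-class basis line
  (the only basis lines through a side point lie in `clF M`).
Paper `proofs/NIGHT-2-g35.md` §5.
-/

namespace PercRepro.Shadow

open PercRepro.ThmH PercRepro.PerFlat

variable {α : Type*} [DecidableEq α] {M : Matroid α} [M.Finite] {G : Finset α}

/-- **A point of `π₂` off the spine on no non-class basis line.** -/
theorem single_class_of_plane_point (hs : ∀ e ∈ gr M, ∀ f ∈ gr M, e ≠ f → rkN M {e, f} = 2)
    {V : Finset α} (hVg : V ⊆ gr M) {R₁ : Finset α} (hR₁V : R₁ ⊆ V) (hR₁2 : rkN M R₁ = 2) {c₂ c₃ : α}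
    (hc₂V : c₂ ∈ V) (hc₃V : c₃ ∈ V) (hc₂ : c₂ ∉ clF M R₁) (hc₃ : c₃ ∉ clF M (insert c₂ R₁))
    (hcover : ∀ e ∈ V, e ∈ clF M (insert c₂ R₁) ∨ e ∈ clF M (insert c₃ R₁))
    {P W : Finset α} (hPV : P ⊆ V) (hWV : W ⊆ V) (hPW : ∀ e ∈ P, e ∉ W) {w₀ x : α}
    {f : α} (hfW : f ∈ W) (hf2 : f ∈ clF M (insert c₂ R₁)) (hfL : f ∉ clF M R₁)
    (hac : ∀ a ∈ P, ∀ c ∈ P, a ≠ c → a ∈ clF M R₁ → c ∈ clF M (insert c₂ R₁) → c ∉ clF M R₁ →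
      f ∈ clF M {a, c} → rkN M (insert w₀ (insert x {a, c})) ≤ 3)
    (hcc : ∀ c ∈ P, ∀ c' ∈ P, c ≠ c' → c ∈ clF M (insert c₂ R₁) → c ∉ clF M R₁ → c' ∈ clF M (insert c₂ R₁) →
      c' ∉ clF M R₁ → f ∈ clF M {c, c'} → rkN M (insert w₀ (insert x {c, c'})) ≤ 3) :
    ∀ a ∈ P, ∀ b ∈ P, a ≠ b → f ∈ clF M {a, b} → rkN M (insert w₀ (insert x {a, b})) ≤ 3 := by
  have hR₁g : R₁ ⊆ gr M := hR₁V.trans hVg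
  have hc₂g : c₂ ∈ gr M := hVg hc₂V
  have hc₃g : c₃ ∈ gr M := hVg hc₃V
  have hfM : f ∉ clF M (V.filter (fun e => e ∈ clF M (insert c₃ R₁) ∧ e ∉ clF M R₁)) :=
    notMem_clF_side_of_plane_two hR₁g hc₂g hc₃g hc₂ hc₃ hf2 hfL
  intro a ha b hb hab hfab
  obtain ⟨haM, hbM⟩ := notMem_side_of_bad_pair hs hVg hR₁V hc₂V hc₃V hc₂ hc₃ hcover hPV hWV hPW ha hb hab hfW
    hfab hfM
  have hnotLL : ¬ (a ∈ clF M R₁ ∧ b ∈ clF M R₁) := by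
    rintro ⟨haL, hbL⟩
    have hsubL : ({a, b} : Finset α) ⊆ clF M R₁ := by
      intro e he
      rw [Finset.mem_insert, Finset.mem_singleton] at he
      rcases he with rfl | rfl
      · exact haL
      · exact hbL
    have hcl : clF M ({a, b} : Finset α) = clF M R₁ :=
      clF_eq_clF_of_subset_clF_of_rkN_le hR₁g hsubL (by rw [hR₁2, hs a (hVg (hPV ha)) b (hVg (hPV hb)) hab])
    rw [hcl] at hfab
    exact hfL hfab
  rcases spine_or_plane_or_side hcover (hPV ha) with haL | ⟨ha2, haL⟩ | haS
  · rcases spine_or_plane_or_side hcover (hPV hb) with hbL | ⟨hb2, hbL⟩ | hbS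
    · exact absurd ⟨haL, hbL⟩ hnotLL
    · exact hac a ha b hb hab haL hb2 hbL hfab
    · exact absurd hbS hbM
  · rcases spine_or_plane_or_side hcover (hPV hb) with hbL | ⟨hb2, hbL⟩ | hbS
    · have hfba : f ∈ clF M ({b, a} : Finset α) := by rwa [Finset.pair_comm]
      have := hac b hb a ha hab.symm hbL ha2 haL hfba
      rwa [Finset.pair_comm]
    · exact hcc a ha b hb hab ha2 haL hb2 hbL hfab
    · exact absurd hbS hbM
  · exact absurd haS haM

/-- **A spine point off `clF M` on no non-class basis line.** -/
theorem single_class_of_spine_point (hs : ∀ e ∈ gr M, ∀ f ∈ gr M, e ≠ f → rkN M {e, f} = 2)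
    {V : Finset α} (hVg : V ⊆ gr M) {R₁ : Finset α} (hR₁V : R₁ ⊆ V) (hR₁2 : rkN M R₁ = 2) {w₀ x : α}
    (hw₀g : w₀ ∈ gr M) (hxg : x ∈ gr M) (hcop : rkN M (insert w₀ (insert x R₁)) ≤ 3) {c₂ c₃ : α}
    (hc₂V : c₂ ∈ V) (hc₃V : c₃ ∈ V) (hc₂ : c₂ ∉ clF M R₁) (hc₃ : c₃ ∉ clF M (insert c₂ R₁))
    (hcover : ∀ e ∈ V, e ∈ clF M (insert c₂ R₁) ∨ e ∈ clF M (insert c₃ R₁))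
    {P W : Finset α} (hPV : P ⊆ V) (hWV : W ⊆ V) (hPW : ∀ e ∈ P, e ∉ W)
    {s : α} (hsW : s ∈ W) (hsL : s ∈ clF M R₁)
    (hsM : s ∉ clF M (V.filter (fun e => e ∈ clF M (insert c₃ R₁) ∧ e ∉ clF M R₁)))
    (hcc : ∀ c ∈ P, ∀ c' ∈ P, c ≠ c' → c ∈ clF M (insert c₂ R₁) → c ∉ clF M R₁ → c' ∈ clF M (insert c₂ R₁) →
      c' ∉ clF M R₁ → s ∈ clF M {c, c'} → rkN M (insert w₀ (insert x {c, c'})) ≤ 3) :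
    ∀ a ∈ P, ∀ b ∈ P, a ≠ b → s ∈ clF M {a, b} → rkN M (insert w₀ (insert x {a, b})) ≤ 3 := by
  have hR₁g : R₁ ⊆ gr M := hR₁V.trans hVg
  intro a ha b hb hab hsab
  obtain ⟨haM, hbM⟩ := notMem_side_of_bad_pair hs hVg hR₁V hc₂V hc₃V hc₂ hc₃ hcover hPV hWV hPW ha hb hab hsW
    hsab hsM
  -- a spine basis point in the pair forces the other into the spine (as in `free_of_spine_point`)
  have key : ∀ u v : α, u ∈ P → v ∈ P → u ≠ v → s ∈ clF M {u, v} → u ∈ clF M R₁ → v ∈ clF M R₁ := by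
    intro u v hu hv huv hsuv huL
    have hug : u ∈ gr M := hVg (hPV hu)
    have hvg : v ∈ gr M := hVg (hPV hv)
    have hsg : s ∈ gr M := hVg (hWV hsW)
    have hsu : s ≠ u := by
      rintro rfl
      exact hPW s hu hsW
    have hus2 : rkN M ({u, s} : Finset α) = 2 := hs u hug s hsg hsu.symm
    have hsubL : ({u, s} : Finset α) ⊆ clF M R₁ := by
      intro e he
      rw [Finset.mem_insert, Finset.mem_singleton] at he
      rcases he with rfl | rfl
      · exact huL
      · exact hsL
    have hcl : clF M ({u, s} : Finset α) = clF M R₁ :=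
      clF_eq_clF_of_subset_clF_of_rkN_le hR₁g hsubL (by rw [hR₁2, hus2])
    have huvg : ({u, v} : Finset α) ⊆ gr M := Finset.insert_subset hug (Finset.singleton_subset_iff.2 hvg)
    have hv : v ∈ clF M ({u, s} : Finset α) := by
      have h1 : ({u, s} : Finset α) ⊆ clF M ({u, v} : Finset α) := by
        intro e he
        rw [Finset.mem_insert, Finset.mem_singleton] at he
        rcases he with rfl | rfl
        · exact subset_clF_of_subset_gr huvg (Finset.mem_insert_self _ _)
        · exact hsuv
      have hcl2 : clF M ({u, s} : Finset α) = clF M ({u, v} : Finset α) :=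
        clF_eq_clF_of_subset_clF_of_rkN_le huvg h1 (by rw [hus2, hs u hug v hvg huv])
      rw [hcl2]
      exact subset_clF_of_subset_gr huvg (Finset.mem_insert_of_mem (Finset.mem_singleton_self _))
    rw [hcl] at hv
    exact hv
  -- the spine is a class line: a basis pair on the spine is a class pair
  have hLcls : a ∈ clF M R₁ → b ∈ clF M R₁ → rkN M (insert w₀ (insert x {a, b})) ≤ 3 := by
    intro haL hbL
    have hXg : insert w₀ (insert x R₁) ⊆ gr M := Finset.insert_subset hw₀g (Finset.insert_subset hxg hR₁g)
    have hsub : insert w₀ (insert x {a, b}) ⊆ clF M (insert w₀ (insert x R₁)) := by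
      intro e he
      rw [Finset.mem_insert, Finset.mem_insert, Finset.mem_insert, Finset.mem_singleton] at he
      rcases he with rfl | rfl | rfl | rfl
      · exact subset_clF_of_subset_gr hXg (Finset.mem_insert_self _ _)
      · exact subset_clF_of_subset_gr hXg (Finset.mem_insert_of_mem (Finset.mem_insert_self _ _))
      · exact clF_mono ((Finset.subset_insert _ _).trans (Finset.subset_insert _ _)) haL
      · exact clF_mono ((Finset.subset_insert _ _).trans (Finset.subset_insert _ _)) hbL
    have := rkN_mono (M := M) hsub
    rw [rkN_clF] at this
    omega
  rcases spine_or_plane_or_side hcover (hPV ha) with haL | ⟨ha2, haL⟩ | haS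
  · rcases spine_or_plane_or_side hcover (hPV hb) with hbL | ⟨hb2, hbL⟩ | hbS
    · exact hLcls haL hbL
    · exact absurd (key a b ha hb hab hsab haL) hbL
    · exact absurd hbS hbM
  · rcases spine_or_plane_or_side hcover (hPV hb) with hbL | ⟨hb2, hbL⟩ | hbS
    · have hsba : s ∈ clF M ({b, a} : Finset α) := by rwa [Finset.pair_comm]
      exact absurd (key b a hb ha hab.symm hsba hbL) haL
    · exact hcc a ha b hb hab ha2 haL hb2 hbL hsab
    · exact absurd hbS hbM
  · exact absurd haS haM

/-- **A side point on no non-class basis line** when the line of `M` is not a non-class basis line: a basis line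
through a side point lies in `clF M`. -/
theorem single_class_of_side_point (hs : ∀ e ∈ gr M, ∀ f ∈ gr M, e ≠ f → rkN M {e, f} = 2)
    {V : Finset α} (hVg : V ⊆ gr M) {R₁ : Finset α} (hR₁V : R₁ ⊆ V) {w₀ x : α} (hw₀g : w₀ ∈ gr M)
    (hxg : x ∈ gr M) {c₂ c₃ : α} (hc₂V : c₂ ∈ V) (hc₃V : c₃ ∈ V) (hc₂ : c₂ ∉ clF M R₁)
    (hc₃ : c₃ ∉ clF M (insert c₂ R₁))
    (hcover : ∀ e ∈ V, e ∈ clF M (insert c₂ R₁) ∨ e ∈ clF M (insert c₃ R₁))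
    {P W : Finset α} (hPV : P ⊆ V) (hWV : W ⊆ V) (hPW : ∀ e ∈ P, e ∉ W)
    (hM : ¬ (4 ≤ rkN M (insert w₀ (insert x (V.filter (fun e => e ∈ clF M (insert c₃ R₁) ∧ e ∉ clF M R₁)))) ∧
      ∃ a ∈ P, ∃ b ∈ P, a ≠ b ∧ a ∈ clF M (V.filter (fun e => e ∈ clF M (insert c₃ R₁) ∧ e ∉ clF M R₁)) ∧
        b ∈ clF M (V.filter (fun e => e ∈ clF M (insert c₃ R₁) ∧ e ∉ clF M R₁))))
    {y₃ : α} (hy₃W : y₃ ∈ W) (hy₃3 : y₃ ∈ clF M (insert c₃ R₁)) (hy₃L : y₃ ∉ clF M R₁) :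
    ∀ a ∈ P, ∀ b ∈ P, a ≠ b → y₃ ∈ clF M {a, b} → rkN M (insert w₀ (insert x {a, b})) ≤ 3 := by
  have hR₁g : R₁ ⊆ gr M := hR₁V.trans hVg
  have hc₂g : c₂ ∈ gr M := hVg hc₂V
  have hc₃g : c₃ ∈ gr M := hVg hc₃V
  have hMg : V.filter (fun e => e ∈ clF M (insert c₃ R₁) ∧ e ∉ clF M R₁) ⊆ gr M :=
    (Finset.filter_subset _ _).trans hVg
  have hy₃V : y₃ ∈ V := hWV hy₃W
  intro a ha b hb hab hyab
  have hag : a ∈ gr M := hVg (hPV ha)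
  have hbg : b ∈ gr M := hVg (hPV hb)
  have hya : y₃ ≠ a := by rintro rfl; exact hPW y₃ ha hy₃W
  have hyb : y₃ ≠ b := by rintro rfl; exact hPW y₃ hb hy₃W
  have habg : ({a, b} : Finset α) ⊆ gr M := Finset.insert_subset hag (Finset.singleton_subset_iff.2 hbg)
  -- the line `{a, b, y₃}` has rank `2`, three points of `V`, and passes through the side point: it lies in `clF M`
  set R : Finset α := {a, b, y₃} with hR
  have hRV : R ⊆ V := by
    intro e he
    rw [hR, Finset.mem_insert, Finset.mem_insert, Finset.mem_singleton] at he
    rcases he with rfl | rfl | rfl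
    · exact hPV ha
    · exact hPV hb
    · exact hy₃V
  have hRg : R ⊆ gr M := hRV.trans hVg
  have hR2 : rkN M R = 2 := by
    have h1 : R ⊆ clF M ({a, b} : Finset α) := by
      intro e he
      rw [hR, Finset.mem_insert, Finset.mem_insert, Finset.mem_singleton] at he
      rcases he with rfl | rfl | rfl
      · exact subset_clF_of_subset_gr habg (Finset.mem_insert_self _ _)
      · exact subset_clF_of_subset_gr habg (Finset.mem_insert_of_mem (Finset.mem_singleton_self _))
      · exact hyab
    have h2 := rkN_mono (M := M) h1
    rw [rkN_clF, hs a hag b hbg hab] at h2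
    have h3 : ({a, b} : Finset α) ⊆ R := by
      intro e he
      rw [Finset.mem_insert, Finset.mem_singleton] at he
      rw [hR, Finset.mem_insert, Finset.mem_insert, Finset.mem_singleton]
      rcases he with rfl | rfl
      · exact Or.inl rfl
      · exact Or.inr (Or.inl rfl)
    have h4 := rkN_mono (M := M) h3
    rw [hs a hag b hbg hab] at h4
    omega
  have hR3 : 3 ≤ R.card := by
    rw [hR, Finset.card_insert_of_notMem, Finset.card_pair hyb.symm]
    rw [Finset.mem_insert, Finset.mem_singleton, not_or]
    exact ⟨hab, hya.symm⟩
  have hyR : y₃ ∈ R := by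
    rw [hR]
    exact Finset.mem_insert_of_mem (Finset.mem_insert_of_mem (Finset.mem_singleton_self _))
  have hRcover : ∀ e ∈ R, e ∈ clF M (insert c₂ R₁) ∨ e ∈ clF M (insert c₃ R₁) := fun e he => hcover e (hRV he)
  have hRπ : R ⊆ clF M (insert c₃ R₁) := by
    rcases subset_plane_of_rkN_le_two_of_cover hs hRg hR2.le hR3 hRcover with h' | h'
    · exact absurd (mem_clF_of_mem_two_planes hR₁g hc₂g hc₃g hc₂ hc₃ (h' hyR) hy₃3) hy₃L
    · exact h'
  have hRM := subset_clF_side_of_mem_side hs hVg hRV hR2 hR3 hRπ hyR hy₃L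
  have haMc : a ∈ clF M (V.filter (fun e => e ∈ clF M (insert c₃ R₁) ∧ e ∉ clF M R₁)) :=
    hRM (by rw [hR]; exact Finset.mem_insert_self _ _)
  have hbMc : b ∈ clF M (V.filter (fun e => e ∈ clF M (insert c₃ R₁) ∧ e ∉ clF M R₁)) :=
    hRM (by rw [hR]; exact Finset.mem_insert_of_mem (Finset.mem_insert_self _ _))
  -- a non-class pair on the line of `M` makes that line a non-class basis line
  by_contra hncls
  apply hM
  refine ⟨?_, a, ha, b, hb, hab, haMc, hbMc⟩
  have hXg : insert w₀ (insert x (V.filter (fun e => e ∈ clF M (insert c₃ R₁) ∧ e ∉ clF M R₁))) ⊆ gr M :=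
    Finset.insert_subset hw₀g (Finset.insert_subset hxg hMg)
  have hsub : insert w₀ (insert x {a, b}) ⊆
      clF M (insert w₀ (insert x (V.filter (fun e => e ∈ clF M (insert c₃ R₁) ∧ e ∉ clF M R₁)))) := by
    intro e he
    rw [Finset.mem_insert, Finset.mem_insert, Finset.mem_insert, Finset.mem_singleton] at he
    rcases he with rfl | rfl | rfl | rfl
    · exact subset_clF_of_subset_gr hXg (Finset.mem_insert_self _ _)
    · exact subset_clF_of_subset_gr hXg (Finset.mem_insert_of_mem (Finset.mem_insert_self _ _))
    · exact clF_mono ((Finset.subset_insert _ _).trans (Finset.subset_insert _ _)) haMc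
    · exact clF_mono ((Finset.subset_insert _ _).trans (Finset.subset_insert _ _)) hbMc
  have := rkN_mono (M := M) hsub
  rw [rkN_clF] at this
  omega

end PercRepro.Shadow
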